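import Summits.CriticalPhenomena.PercolationContinuityZ3.Theorems.PercNearOneGluingNoHeavyLowerTailMajorityGluingHubOnlyWeak
import HarnessLib

/-!
# Majority gluing with loss `2·max` at a GIVEN relay set from the weak percolation-EKR bound at the single size `(|A| − 2, ⌈|A|/2⌉)`
# (lane prim-rate, constants-miner 1, gen 3 — the per-size re-typing of rows M1-E1w′ / M1-L2 for the open window `6 ≤ |A| ≤ 55`)

Support file for the closed crux `NoHeavyLowerTail` (stmt-CriticalPhenomena-4575; `--supports … --as helper`), continuing
`…MajorityGluingHubOnlyWeak.lean` (p312163) / `…HubOnlyWeakRepair.lean` (p314265) / `…HubOnlyUniformRepair.lean` (p314578).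

STATE OF THE ROW (2026-08-22).  The weak (ballot-type) percolation-EKR bound «marginals `≤ δ ≤ 1/2` on `T ∌ a₀`, `|T| < 2h` ⟹
`μ(h ≤ #cut) ≤ δ/(1−δ)`» is FALSE as a statement over all sizes (refuter seat mine-ref-g10, `refutations/M1-E1w-prime.json`: two-block hub
trees, `|T| = 31`, `h = 16`), so the conditional kernel theorems p312163 / p314265 (hypothesis = all sizes) are vacuous as typed; and majority
gluing with loss `2·max` is itself FALSE for `|A| ≥ 56` (`refutations/M1-H1-L2-L1.json`; kernel: `HubOnly.not_hubOnly_two`,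
`…MajorityGluingSharpThree.lean`), the universal constant being exactly `3`.  What remains open is the WINDOW `6 ≤ |A| ≤ 55`, where every census
sits at `2`.  This file isolates, for a GIVEN relay set `A` with hub `a₀`, the one instance of the weak bound that the kernel chain consumes:

  `WeakAt(A, a₀)`: for every non-degenerate weight function `p` on the same vertex set, every `T ⊆ A ∖ {a₀}` with `|T| + 2 = |A|` and every
  `0 ≤ δ ≤ 1/2` bounding `μ_p(v ↮ a₀)` on `T`:  `μ_p(⌈|A|/2⌉ ≤ #{v ∈ T : v ↮ a₀}) ≤ δ/(1−δ)`,

and proves `WeakAt(A, a₀) ⟹ μ(o ↔ a₀ ∧ 2N > |A|) ≥ μ(o ↔ A) − 2·max_{a∈A} μ(a ↮ a₀)` for every observer and weight function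
(`HubOnly.majorityGluing_two_of_weakEKR_at`).  Proof = p314265's Harris argument with p314578's peeling: for `a ∈ A` pick `c ≠ a₀` (`c = a`
unless `a = a₀`); `H_a ⊆ {c ↮ a₀} ∪ ({c ↔ a₀} ∩ {⌈|A|/2⌉ ≤ #cut(A ∖ {a₀, c})})`, Harris (increasing × decreasing) and
`δ_c + (1 − δ_c)·M/(1−M) ≤ 2M`.  CONVERSELY (paper, one line; recorded in `prim-rate-mine-1/CANDIDATES.md` §GEN-3): if the weak bound fails at
size `(k − 2, ⌈k/2⌉)` on some `(T, a₀)` with `max = δ`, a pendant relay `a` on `a₀` with `μ(a ↮ a₀) = δ` gives `μ(H_a) = δ + (1−δ)·μ(#cut ≥ ⌈k/2⌉)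
> 2δ` at `|A| = k`; so «`C(k) = 2`» ⟺ «weak EKR at `(k−2, ⌈k/2⌉)`» for every `k`, and the window question is exactly the list of sizes
`(4,3), (5,4), (6,4), …, (53,28)` of the weak bound.  No definitions, no named facts, no sorries.
[cite: KozmaNitzan2024, Conj. 1 (p. 3), Conj. 4 (p. 32)]
-/

noncomputable section

namespace Summit.CriticalPhenomena.PercolationContinuityZ3.Theorems

open MeasureTheory Set
open Literature.Probability.LatticeModels (prodBernoulli)
open Literature.Probability.Percolation
open scoped Classical

namespace HubOnly

variable {n : ℕ}

/-- **MAJORITY GLUING WITH LOSS `2·max` AT A GIVEN RELAY SET, FROM THE WEAK PERCOLATION-EKR BOUND AT THE SINGLE SIZE `(|A| − 2, ⌈|A|/2⌉)`.**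
HYPOTHESIS `WeakAt(A, a₀)` (see the module docstring): for all non-degenerate `p` on `Fin n`, all `T ⊆ A ∖ {a₀}` with `|T| + 2 = |A|`, all
`0 ≤ δ ≤ 1/2` with `μ_p(v ↮ a₀) ≤ δ` on `T`: `μ_p(⌈|A|/2⌉ ≤ #cut T) ≤ δ/(1−δ)`.  CONCLUSION: for every observer `o`, weight function `w` and
bound `δ₀ ≥ μ(a ↮ a₀)` on `A`:  `μ(o ↔ A) − 2δ₀ ≤ μ(o ↔ a₀ ∧ |A| < 2N)`.  For `|A| = 6` the hypothesis is the `(4,3)` weak bound on the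
4-subsets of `A ∖ {a₀}` — the first cell of the open window; its failure anywhere would conversely give `C(|A|) > 2` (pendant relay).
[cite: KozmaNitzan2024, Conj. 1 (p. 3), Conj. 4 (p. 32)] -/
theorem majorityGluing_two_of_weakEKR_at (w : Sym2 (Fin n) → unitInterval) (A : Finset (Fin n)) (o a₀ : Fin n) (δ₀ : ℝ)
    (ha₀ : a₀ ∈ A)
    (hW : ∀ (p : Sym2 (Fin n) → unitInterval), (∀ e, 0 < p e ∧ p e < 1) →
      ∀ (T : Finset (Fin n)) (δ : ℝ), a₀ ∉ T → T ⊆ A → T.card + 2 = A.card → 0 ≤ δ → δ ≤ 1 / 2 →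
      (∀ v ∈ T, (prodBernoulli p).real (openConn v a₀ : Set (BondConfig (Fin n)))ᶜ ≤ δ) →
      (prodBernoulli p).real {ω : BondConfig (Fin n) | (A.card + 1) / 2 ≤ (T.filter fun v => ω ∉ openConn v a₀).card} ≤ δ / (1 - δ))
    (hδ₀ : ∀ a ∈ A, (prodBernoulli w).real (openConn a a₀ : Set (BondConfig (Fin n)))ᶜ ≤ δ₀) :
    (prodBernoulli w).real (⋃ a ∈ A, openConn o a) - 2 * δ₀ ≤
      (prodBernoulli w).real {ω : BondConfig (Fin n) | ω ∈ openConn o a₀ ∧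
          A.card < 2 * (A.filter fun a => ω ∈ openConn o a).card} := by
  have h := majorityGluing_of_hubOnly (n := n) 2 zero_le_two A a₀ ha₀ ?_ w o δ₀ hδ₀
  · linarith
  intro p hp a ha
  set μ := prodBernoulli p with hμ
  have hms : ∀ S : Set (BondConfig (Fin n)), MeasurableSet S := fun _ => MeasurableSet.of_discrete
  set δ : Fin n → ℝ := fun x => μ.real (openConn x a₀ : Set (BondConfig (Fin n)))ᶜ with hδ
  set M := A.sup' ⟨a₀, ha₀⟩ δ with hM
  have hδle : ∀ x ∈ A, δ x ≤ M := fun x hx => Finset.le_sup' δ hx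
  have hM0 : 0 ≤ M := le_trans measureReal_nonneg (hδle a₀ ha₀)
  set H : Set (BondConfig (Fin n)) := {ω | ω ∈ openConn a a₀ →
      2 * (A.filter fun a' => ω ∈ openConn a' a₀).card ≤ A.card} with hH
  by_cases hbig : 1 / 2 < M
  · have : μ.real H ≤ 1 := measureReal_le_one
    linarith
  have hbig' : M ≤ 1 / 2 := not_lt.1 hbig
  by_cases hA1 : A.card = 1
  · -- `A = {a₀}`: the hub event is empty
    have haa : a = a₀ := by
      obtain ⟨x, hx⟩ := Finset.card_eq_one.1 hA1
      rw [hx] at ha ha₀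
      rw [Finset.mem_singleton.1 ha, Finset.mem_singleton.1 ha₀]
    subst haa
    have hempty : H = ∅ := by
      ext ω
      simp only [hH, mem_setOf_eq, mem_empty_iff_false, iff_false, Classical.not_imp, not_le]
      refine ⟨(SimpleGraph.Reachable.refl _ : (openGraph ω).Reachable a a), ?_⟩
      have h0 : a ∈ A.filter fun a' => ω ∈ openConn a' a :=
        Finset.mem_filter.2 ⟨ha, (SimpleGraph.Reachable.refl _ : (openGraph ω).Reachable a a)⟩
      have : 1 ≤ (A.filter fun a' => ω ∈ openConn a' a).card := Finset.card_pos.2 ⟨a, h0⟩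
      omega
    rw [hempty, measureReal_empty]; linarith
  -- peel a relay `c ≠ a₀`, equal to `a` unless `a = a₀`
  obtain ⟨c, hcA, hca₀, hca⟩ : ∃ c ∈ A, c ≠ a₀ ∧ (a ≠ a₀ → c = a) := by
    by_cases haa : a = a₀
    · have hpos : 1 < A.card := by
        have := Finset.card_pos.2 ⟨a₀, ha₀⟩; omega
      obtain ⟨c, hc, hne⟩ := Finset.exists_mem_ne hpos a₀
      exact ⟨c, hc, hne, fun h => (h haa).elim⟩
    · exact ⟨a, ha, haa, fun _ => rfl⟩
  set T : Finset (Fin n) := (A.erase a₀).erase c with hT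
  set hh : ℕ := (A.card + 1) / 2 with hhh
  have hcT : c ∈ A.erase a₀ := Finset.mem_erase.2 ⟨hca₀, hcA⟩
  have hTcard : T.card + 2 = A.card := by
    have hk : 1 ≤ A.card := Finset.card_pos.2 ⟨a₀, ha₀⟩
    rw [hT, Finset.card_erase_of_mem hcT, Finset.card_erase_of_mem ha₀]
    omega
  have hTA : T ⊆ A := (Finset.erase_subset _ _).trans (Finset.erase_subset _ _)
  have ha₀T : a₀ ∉ T := fun h' => Finset.ne_of_mem_erase (Finset.mem_of_mem_erase h') rfl |>.elim
  set K : Set (BondConfig (Fin n)) := {ω | hh ≤ (T.filter fun v => ω ∉ openConn v a₀).card} with hK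
  -- `H ⊆ {c ↮ a₀} ∪ ({c ↔ a₀} ∩ K)`
  have hsub : H ⊆ (openConn c a₀ : Set (BondConfig (Fin n)))ᶜ ∪ ((openConn c a₀ : Set (BondConfig (Fin n))) ∩ K) := by
    intro ω hω
    by_cases hcc : ω ∈ openConn c a₀
    · right
      refine ⟨hcc, ?_⟩
      have haa : ω ∈ openConn a a₀ := by
        by_cases h' : a = a₀
        · rw [h']; exact (SimpleGraph.Reachable.refl _ : (openGraph ω).Reachable a₀ a₀)
        · rw [← hca h']; exact hcc
      have hle := hω haa
      have hsplit := Finset.card_filter_add_card_filter_not (s := A) (fun a' => ω ∈ openConn a' a₀)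
      have hcut : (A.filter fun a' => ¬ ω ∈ openConn a' a₀) ⊆ T.filter fun v => ω ∉ openConn v a₀ := by
        intro x hx
        rw [Finset.mem_filter] at hx ⊢
        refine ⟨?_, hx.2⟩
        rw [hT, Finset.mem_erase, Finset.mem_erase]
        refine ⟨?_, ?_, hx.1⟩
        · rintro rfl; exact hx.2 hcc
        · rintro rfl; exact hx.2 (SimpleGraph.Reachable.refl _ : (openGraph ω).Reachable x x)
      have hc := Finset.card_le_card hcut
      simp only [hK, mem_setOf_eq]
      omega
    · left; exact hcc
  -- the weak bound for `K` at the single size `(|A| − 2, ⌈|A|/2⌉)`, and Harris for `{c ↔ a₀} ∩ K`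
  have hKb : μ.real K ≤ M / (1 - M) :=
    hW p hp T M ha₀T hTA hTcard hM0 hbig' (fun v hv => hδle v (hTA hv))
  have hHarris : μ.real ((openConn c a₀ : Set (BondConfig (Fin n))) ∩ K) ≤
      μ.real (openConn c a₀ : Set (BondConfig (Fin n))) * μ.real K :=
    Literature.Probability.LatticeModels.prodBernoulli_harris_upper_lower p (isUpperSet_openConn c a₀)
      (isLowerSet_thresholdCut T a₀ hh) (hms _) (hms _)
  have hconn : μ.real (openConn c a₀ : Set (BondConfig (Fin n))) = 1 - δ c := by
    have := probReal_compl_eq_one_sub (μ := μ) (hms (openConn c a₀ : Set (BondConfig (Fin n))))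
    simp only [hδ]; linarith
  have hδc : δ c ≤ M := hδle c hcA
  have hδc0 : 0 ≤ δ c := measureReal_nonneg
  have hK0 : 0 ≤ μ.real K := measureReal_nonneg
  have hB1 : M / (1 - M) ≤ 1 := by
    rw [div_le_one (by linarith)]; linarith
  have h1M : (1 : ℝ) - M ≠ 0 := by intro h; linarith
  have hMid : (1 - M) * (M / (1 - M)) = M := by field_simp
  calc μ.real H ≤ μ.real ((openConn c a₀ : Set (BondConfig (Fin n)))ᶜ ∪ ((openConn c a₀ : Set (BondConfig (Fin n))) ∩ K)) :=
        measureReal_mono hsub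
    _ ≤ μ.real (openConn c a₀ : Set (BondConfig (Fin n)))ᶜ + μ.real ((openConn c a₀ : Set (BondConfig (Fin n))) ∩ K) :=
        measureReal_union_le _ _
    _ ≤ δ c + (1 - δ c) * μ.real K := by rw [← hconn]; exact add_le_add le_rfl hHarris
    _ ≤ δ c + (1 - δ c) * (M / (1 - M)) := by nlinarith [hKb, hδc, hbig']
    _ ≤ M + (1 - M) * (M / (1 - M)) := by nlinarith [hB1, hδc, hM0, hK0]
    _ = 2 * M := by rw [hMid]; ring

end HubOnly

end Summit.CriticalPhenomena.PercolationContinuityZ3.Theorems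

end
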